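import Summits.QuantumFields.YangMills.Theorems.BalabanUVNodesPortS1FEPolyObjects
import Summits.QuantumFields.YangMills.Theorems.BalabanUVNodesPortS1LocalFormula
import Summits.QuantumFields.YangMills.Theorems.BalabanUVNodesK0RecordFormatNamesLemmas17
import Summits.QuantumFields.YangMills.Theorems.BalabanUVNodesPortS1LZHalfRegL
import Literature.MathematicalPhysics.QuantumFieldTheory.Balaban1983to89.B14Eq347Torus

/-!
# PT-S1 ∕ ⟨27930⟩ — S₄ `FEPolymerResummation`, LEAF (A) = THE TORUS ROWS: the (1.18) bound and Kotecký–Preiss smallness FROM S₄'s OWN BINDERS, `log Ξ = Σ_{X ∈ 𝐃} E(X)`,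
# (1.7) locality of the activities, ★★ the identity (7) `Σ_X fePieceT n X (cut_X B) = log Ξ(B) − log Ξ(0)`, and rows (b)(c)(d) for the torus pieces

Cell `ym-nodeO-ideate` ∕ `ym-balaban-port`, DEFINER seat `ym-nodeO-def-1` (gen 39), S₄ assigned by ★★★ director-ym №638 (2) (nodeO STATUS 2026-08-31 l.6180; plan l.6197; ◆ plan cut
l.6247 «no hole; (f2) numerics re-derived»); `--kind proof --supports stmt-QuantumFields-27930 --as helper`; count-neutral.  [I] = [Balaban1987RG1], [II] = [Balaban1988RG2Cluster].

WHAT THIS FILE IS (bookkeeping over the tree's PROVED Kotecký–Preiss engine; nothing of Bałaban asserted):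
* §5 THE ENGINE's LETTERS FROM S₄'s BINDERS (the director's (f2) point, in the kernel; `d = 4`: `c₁ = 64`, `ν = 9`): with `τ := A e^{5κ+1} K₀ 9`, `b := 5κ`, `r₁ := κ`, S₄'s
  `A e^{5κ+1} K₀ 9·64 ≤ 1` and `κ + 2κ₀ + 2 ≤ R` ARE lit `B14.Eq347Torus.norm_locE_torus_le`'s and `isKPVolume_torus_of_decay`'s smallness∕rate letters: `norm_locE_torus_le_of_subset` (decay asked
  only for `Z ⊆ Y`, the others zeroed by `locE_congr`), ★ `norm_locE_torus_le_S4` (`‖E(Y)‖ ≤ e·9·64·K₀²·A·e^{−κ d(Y)}`), ★ `isKPVolume_torus_S4`; `polymerLogZ_eq_sum_locE_dom` (`log Ξ = Σ_{X ∈ 𝐃} E(X)`: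
  lit `logZ_eq_sum_locE` re-indexed by the domains — `Φ^T(∅) = 0`, disconnected unions carry `E = 0` by lit `locE_eq_zero_of_not_isTDom`).
* §6 AT THE RECORD: `feActAt_congr_of_agreeOnSet` ((1.7) locality of every activity: `Hw.LocalOnW` ∕ ✓`local17_cpair_of_intLocalFormula`), `agreeOnSet_pairCutTorusAt_of_subset` (cut pairs to `X ⊇ Z` and
  to `Z` agree on the sites of `Z`), `feLocE_pairCutTorusAt` (`E(X)` at a cut pair reads the gas's own activities `fePolyAct`), `norm_fePolyAct_le` (decay at cut pairs from `CutsInUc` + S₃'s row at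
  `X = Z`), ★★ `sum_fePieceT_pairCutTorusAt` — THE IDENTITY (7) ON THE TORUS (✓`pairCutTorusAt_zero`: the cut pairs of `0` are the unit pair).
* §7 ROWS FOR THE TORUS PIECES: `norm_feLocE_le`, ★ `norm_fePieceT_le` ((b): `E₂ e^{−κ d(X)}` from `2·(e·9·64·K₀²·A) ≤ E₂`, the unit pair lying in `U^c(X)`), ★ `fePieceT_congr_of_agreeOnSet` ((c)),
  `feActAt_cAct` ∕ ★ `fePieceT_cAct` ((d), via `Hw.GaugeInvOnW` ∕ ✓`gaugeInv119_cpair_of_intLocalFormula`).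
Leaf (D) adds analyticity ((a)) and assembles ★★★`fePolymerResummation_holds`.

HONEST FRAMING.  Antecedent-free bookkeeping for the candidate letter S₄ (NOT a Bałaban estimate); S₁ (XL) ∕ S₃ (XXL, the wall) ∕ `FEStepReg` untouched and inhabited nowhere; ⟨27930⟩ OPEN;
K0ᴬ ∕ K1ᴬ ∕ K3ᴬ OPEN; NODE O 0∕1; COUNT 8∕28 · K 1∕4 UNMOVED; finite `𝕋⁴_{L^K}` at fixed ε — NOT continuum ∕ ℝ⁴ ∕ OS; **the Yang–Mills mass gap (Clay) is NOT proved by any of this.**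
No `sorry`, `instance`, `notation`; standard axioms.
-/

noncomputable section

open scoped BigOperators Matrix.Norms.L2Operator Topology

namespace Summit.QuantumFields.YangMills.Theorems.BalabanUVNodesPortS1

open Summit.QuantumFields.YangMills.Theorems.K0RecordFormatNames
open Literature.MathematicalPhysics.QuantumFieldTheory.Balaban1983to89
open Literature.MathematicalPhysics.QuantumFieldTheory.Balaban1983to89.Node00
open Literature.MathematicalPhysics.QuantumFieldTheory.Balaban1983to89.T4Continuum (T4Family)
open Literature.MathematicalPhysics.QuantumFieldTheory.Balaban1983to89.TreeLengthTorusGeometry (TTouch ttouch_refl ttouch_symm)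
open Literature.MathematicalPhysics.QuantumFieldTheory.Balaban1983to89.B13Resummation (locE)
open _root_.Filter

/-! ## §5  The torus engine's letters from S₄'s binders: the (1.18)-shape bound and Kotecký–Preiss smallness -/

section Engine

open Literature.MathematicalPhysics.QuantumFieldTheory.Balaban1983to89.TreeLengthTorus (TPt IsTDom TDom torusTreeLen torusTreeLen_nonneg)
open Literature.MathematicalPhysics.QuantumFieldTheory.Balaban1983to89.B12TreeDecay (kappa₀ K₀ K₀_pos kappa₀_nonneg)
open Literature.MathematicalPhysics.QuantumFieldTheory.Balaban1983to89.B13Resummation (locE_congr)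
open Literature.MathematicalPhysics.QuantumFieldTheory.Balaban1983to89.B14.Eq347Torus (norm_locE_torus_le isKPVolume_torus_of_decay locE_eq_zero_of_not_isTDom)
open Literature.Probability.LatticeModels (IsKPVolume polymerLogZ truncatedWeight kpTerm)

variable {N : ℕ} [NeZero N]

open scoped Classical in
/-- **A localised part reads only the activities of the polymers inside its support**, so the decay may be asked there only: lit `norm_locE_torus_le` with `‖H Z‖ ≤ A e^{−R d(Z)}`
for `Z ⊆ Y` (the others zeroed — `locE_congr`). [cite: Balaban1988RG2Cluster, (2.13) p.14, (2.39)–(2.41) p.21] -/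
theorem norm_locE_torus_le_of_subset {d : ℕ} {H : TDom d N → ℂ} {A R r₁ b τ : ℝ} (hA : 0 ≤ A) (hτ : 0 ≤ τ) (hr₁ : 0 ≤ r₁)
    (hb : r₁ * 5 ≤ b) {Y : Finset (TPt d N)} (hY : IsTDom Y)
    (hH : ∀ Z : TDom d N, Z.1 ⊆ Y → ‖H Z‖ ≤ A * Real.exp (-(R * torusTreeLen Z.1)))
    (hrate : r₁ + 2 * kappa₀ (4 * 2 ^ d) (2 * d) + 1 + τ * (4 * 2 ^ d) ≤ R)
    (hsmall : A * Real.exp (b + τ * (4 * 2 ^ d)) * K₀ (4 * 2 ^ d) (2 * d) * (2 * (d : ℝ) + 1) ≤ τ) :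
    ‖locE TTouch (fun Z : TDom d N => Z.1) H Y‖ ≤
      τ * (4 * 2 ^ d) * K₀ (4 * 2 ^ d) (2 * d) * Real.exp (-b) * Real.exp (-(r₁ * torusTreeLen Y)) := by
  set H' : TDom d N → ℂ := fun Z => if Z.1 ⊆ Y then H Z else 0 with hH'
  have hcongr : locE TTouch (fun Z : TDom d N => Z.1) H Y = locE TTouch (fun Z : TDom d N => Z.1) H' Y :=
    locE_congr TTouch fun Z hZ => by simp only [hH', hZ, if_true]
  rw [hcongr]
  refine norm_locE_torus_le hA hτ hr₁ hb (fun Z => ?_) hrate hsmall hY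
  by_cases hZ : Z.1 ⊆ Y
  · simp only [hH', hZ, if_true]; exact hH Z hZ
  · simp only [hH', hZ, if_false, norm_zero]; positivity

open scoped Classical in
/-- **S₄'s NUMERICS CLOSE THE ENGINE's LETTERS** (`d = 4`: `c₁ = 64`, `ν = 9`; `τ := A e^{5κ+1} K₀ 9`, `b := 5κ`, `r₁ := κ`): the binders `4κ₀ ≤ κ`, `κ + 2κ₀ + 2 ≤ R`,
`A e^{5κ+1} K₀ 9·64 ≤ 1` give `‖E(Y)‖ ≤ e·9·64·K₀²·A·e^{−κ d(Y)}` for every torus localisation domain `Y` whose sub-polymers' activities decay like `A e^{−R d(Z)}` (the director's (f2) point,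
in the kernel). [cite: Balaban1988RG2Cluster, (2.41) p.21; Balaban1987RG1, (1.18) p.263] -/
theorem norm_locE_torus_le_S4 {H : TDom 4 N → ℂ} {A R κ : ℝ} (hA : 0 ≤ A)
    (hκ : 4 * kappa₀ (4 * 2 ^ 4) (2 * 4) ≤ κ) (hR : κ + 2 * kappa₀ (4 * 2 ^ 4) (2 * 4) + 2 ≤ R)
    (hsm : A * Real.exp (5 * κ + 1) * K₀ (4 * 2 ^ 4) (2 * 4) * 9 * 64 ≤ 1)
    {Y : Finset (TPt 4 N)} (hY : IsTDom Y)
    (hH : ∀ Z : TDom 4 N, Z.1 ⊆ Y → ‖H Z‖ ≤ A * Real.exp (-(R * torusTreeLen Z.1))) :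
    ‖locE TTouch (fun Z : TDom 4 N => Z.1) H Y‖ ≤
      Real.exp 1 * 9 * 64 * K₀ (4 * 2 ^ 4) (2 * 4) ^ 2 * A * Real.exp (-(κ * torusTreeLen Y)) := by
  have hκ₀ : 0 ≤ kappa₀ (4 * 2 ^ 4) (2 * 4) := kappa₀_nonneg (by norm_num) _
  have hK₀ : 0 < K₀ (4 * 2 ^ 4) (2 * 4) := K₀_pos _ _
  have hκ0 : 0 ≤ κ := le_trans (by positivity) hκ
  set τ : ℝ := A * Real.exp (5 * κ + 1) * K₀ (4 * 2 ^ 4) (2 * 4) * 9 with hτ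
  have hτ0 : 0 ≤ τ := by positivity
  have h64 : τ * 64 ≤ 1 := by rw [hτ]; linarith [hsm]
  have h64' : τ * (4 * 2 ^ 4 : ℝ) ≤ 1 := by norm_num; linarith
  have hrate : κ + 2 * kappa₀ (4 * 2 ^ 4) (2 * 4) + 1 + τ * (4 * 2 ^ 4) ≤ R := by linarith
  have hsmall : A * Real.exp (5 * κ + τ * (4 * 2 ^ 4)) * K₀ (4 * 2 ^ 4) (2 * 4) * (2 * ((4 : ℕ) : ℝ) + 1) ≤ τ := by
    have hexp : Real.exp (5 * κ + τ * (4 * 2 ^ 4)) ≤ Real.exp (5 * κ + 1) := Real.exp_le_exp.2 (by norm_num; linarith)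
    calc A * Real.exp (5 * κ + τ * (4 * 2 ^ 4)) * K₀ (4 * 2 ^ 4) (2 * 4) * (2 * ((4 : ℕ) : ℝ) + 1)
        = (2 * ((4 : ℕ) : ℝ) + 1) * (A * K₀ (4 * 2 ^ 4) (2 * 4)) * Real.exp (5 * κ + τ * (4 * 2 ^ 4)) := by ring
      _ ≤ (2 * ((4 : ℕ) : ℝ) + 1) * (A * K₀ (4 * 2 ^ 4) (2 * 4)) * Real.exp (5 * κ + 1) :=
          mul_le_mul_of_nonneg_left hexp (by positivity)
      _ = τ := by rw [hτ]; norm_num; ring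
  have h := norm_locE_torus_le_of_subset (d := 4) hA hτ0 hκ0 (b := 5 * κ) (by linarith) hY hH hrate hsmall
  refine h.trans (le_of_eq ?_)
  rw [hτ, show -(5 * κ) = (1 : ℝ) - (5 * κ + 1) by ring, Real.exp_sub, pow_two]
  have hne : Real.exp (5 * κ + 1) ≠ 0 := (Real.exp_pos _).ne'
  field_simp
  norm_num
  ring

open scoped Classical in
/-- **KOTECKÝ–PREISS FOR THE WHOLE TORUS GAS FROM S₄'s BINDERS** (`τ := A e^{5κ+1} K₀ 9`; size function `a(Z) = τ·#Z`): lit `isKPVolume_torus_of_decay` with its two letters read off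
`κ + 2κ₀ + 2 ≤ R` and `A e^{5κ+1} K₀ 9·64 ≤ 1`. [cite: Balaban1988RG2Cluster, p.20 (after (2.38)); KoteckyPreiss1986, (1)] -/
theorem isKPVolume_torus_S4 {H : TDom 4 N → ℂ} {A R κ : ℝ} (hA : 0 ≤ A)
    (hκ : 4 * kappa₀ (4 * 2 ^ 4) (2 * 4) ≤ κ) (hR : κ + 2 * kappa₀ (4 * 2 ^ 4) (2 * 4) + 2 ≤ R)
    (hsm : A * Real.exp (5 * κ + 1) * K₀ (4 * 2 ^ 4) (2 * 4) * 9 * 64 ≤ 1)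
    (hH : ∀ Z : TDom 4 N, ‖H Z‖ ≤ A * Real.exp (-(R * torusTreeLen Z.1))) :
    IsKPVolume TTouch H (fun Z : TDom 4 N => A * Real.exp (5 * κ + 1) * K₀ (4 * 2 ^ 4) (2 * 4) * 9 * (Z.1.card : ℝ)) Finset.univ := by
  have hκ₀ : 0 ≤ kappa₀ (4 * 2 ^ 4) (2 * 4) := kappa₀_nonneg (by norm_num) _
  have hK₀ : 0 < K₀ (4 * 2 ^ 4) (2 * 4) := K₀_pos _ _
  have hκ0 : 0 ≤ κ := le_trans (by positivity) hκ
  set τ : ℝ := A * Real.exp (5 * κ + 1) * K₀ (4 * 2 ^ 4) (2 * 4) * 9 with hτ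
  have hτ0 : 0 ≤ τ := by positivity
  have h64 : τ * 64 ≤ 1 := by rw [hτ]; linarith [hsm]
  have h64' : τ * (4 * 2 ^ 4 : ℝ) ≤ 1 := by norm_num; linarith
  have hrate : kappa₀ (4 * 2 ^ 4) (2 * 4) + τ * (4 * 2 ^ 4) ≤ R := by linarith
  have hsmall : A * Real.exp (τ * (4 * 2 ^ 4)) * K₀ (4 * 2 ^ 4) (2 * 4) * (2 * ((4 : ℕ) : ℝ) + 1) ≤ τ := by
    have hexp : Real.exp (τ * (4 * 2 ^ 4)) ≤ Real.exp (5 * κ + 1) := Real.exp_le_exp.2 (by nlinarith)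
    calc A * Real.exp (τ * (4 * 2 ^ 4)) * K₀ (4 * 2 ^ 4) (2 * 4) * (2 * ((4 : ℕ) : ℝ) + 1)
        = (2 * ((4 : ℕ) : ℝ) + 1) * (A * K₀ (4 * 2 ^ 4) (2 * 4)) * Real.exp (τ * (4 * 2 ^ 4)) := by ring
      _ ≤ (2 * ((4 : ℕ) : ℝ) + 1) * (A * K₀ (4 * 2 ^ 4) (2 * 4)) * Real.exp (5 * κ + 1) :=
          mul_le_mul_of_nonneg_left hexp (by positivity)
      _ = τ := by rw [hτ]; norm_num; ring
  exact isKPVolume_torus_of_decay (d := 4) hA hτ0 hH hrate hsmall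

open scoped Classical in
/-- **`log Ξ = Σ_{X ∈ 𝐃} E(X)` ON THE TORUS** under Kotecký–Preiss: lit `logZ_eq_sum_locE` (sum over all unions of families) re-indexed by the localisation domains — the empty union
carries `Φ^T(∅) = 0` and the disconnected unions carry `E = 0` (lit `locE_eq_zero_of_not_isTDom`). [cite: Balaban1988RG2Cluster, (2.12)–(2.13) p.14] -/
theorem polymerLogZ_eq_sum_locE_dom {d : ℕ} {H : TDom d N → ℂ} {a : TDom d N → ℝ} (hKP : IsKPVolume TTouch H a Finset.univ) :
    polymerLogZ TTouch H (Finset.univ : Finset (TDom d N)) = ∑ X : TDom d N, locE TTouch (fun Z : TDom d N => Z.1) H X.1 := by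
  rw [B13Resummation.logZ_eq_sum_locE TTouch (fun Z : TDom d N => Z.1) H]
  set U := (Finset.univ : Finset (TDom d N)).powerset.image (fun C => C.biUnion fun Z : TDom d N => Z.1) with hU
  -- the non-domain unions carry nothing
  have hzero : ∀ Y ∈ U, ¬ IsTDom Y → locE TTouch (fun Z : TDom d N => Z.1) H Y = 0 := by
    intro Y _ hY
    by_cases hYne : Y.Nonempty
    · exact locE_eq_zero_of_not_isTDom hKP hYne hY
    · rw [Finset.not_nonempty_iff_eq_empty] at hYne
      subst hYne
      unfold locE
      refine Finset.sum_eq_zero fun C hC => ?_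
      obtain ⟨-, hCU⟩ := B13FamilySum.mem_coveringFamilies.1 hC
      have hC0 : C = ∅ := by
        by_contra hne
        obtain ⟨Z, hZ⟩ := Finset.nonempty_iff_ne_empty.2 hne
        obtain ⟨c, hc⟩ := Z.2.1
        have : c ∈ C.biUnion (fun Z : TDom d N => Z.1) := Finset.mem_biUnion.2 ⟨Z, hZ, hc⟩
        rw [hCU] at this
        exact Finset.notMem_empty c this
      subst hC0
      exact Literature.Probability.LatticeModels.truncatedWeight_empty _
  rw [← Finset.sum_filter_of_ne (fun Y hY hne => by_contra fun h => hne (hzero Y hY h))]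
  symm
  refine Finset.sum_bij (fun (X : TDom d N) _ => X.1) (fun X _ => ?_) (fun X _ X' _ h => Subtype.ext h) (fun Y hY => ?_) (fun X _ => rfl)
  · refine Finset.mem_filter.2 ⟨Finset.mem_image.2 ⟨{X}, Finset.mem_powerset.2 (Finset.subset_univ _), by simp⟩, X.2⟩
  · obtain ⟨-, hYd⟩ := Finset.mem_filter.1 hY
    exact ⟨⟨Y, hYd⟩, Finset.mem_univ _, rfl⟩

end Engine

/-! ## §6  At the record: the cut pair of `B = 0`, locality of the activities, the localised parts at cut pairs, and the identity (7) -/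

section Record

open Literature.MathematicalPhysics.QuantumFieldTheory.Balaban1983to89.TreeLengthTorus (TPt IsTDom TDom torusTreeLen)
open Literature.MathematicalPhysics.QuantumFieldTheory.Balaban1983to89.B12TreeDecay (kappa₀ K₀ K₀_pos kappa₀_nonneg)
open Literature.MathematicalPhysics.QuantumFieldTheory.Balaban1983to89.B13Resummation (locE_congr)
open Literature.Probability.LatticeModels (IsKPVolume polymerLogZ)

variable (F : T4Family)

variable {F}

/-- **(1.7) LOCALITY OF EVERY ACTIVITY**: `feActAt n Z` reads the pair only on the sites of `Z` — `Hw.LocalOnW` on the wrap class, ✓`local17_cpair_of_intLocalFormula` for `Hi`'s pull-back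
pieces off it. [cite: Balaban1987RG1, (1.7) p.261; Balaban1988RG2Cluster, (2.11) p.14] -/
theorem feActAt_congr_of_agreeOnSet {Mc k : ℕ} (hMc : McGuard F Mc) {Hi : IntLocalFormula (F.L ^ (k + 1) * Mc)} {Hw : TorusPieces F Mc k} (hloc : Hw.LocalOnW F)
    (n : ℕ) (Z : (recordDomSys F Mc k (recordK₀ F Mc k + n)).Dom) {φ ψ : Sect2.CPair (F.P (recordK₀ F Mc k + n)) (MatA 2)}
    (h : Sect2.agreeOnSet (Sect2.domSites (F.P (recordK₀ F Mc k + n)) Mc (k + 1) Z) φ ψ) :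
    feActAt F Mc k Hi Hw n Z φ = feActAt F Mc k Hi Hw n Z ψ := by
  classical
  unfold feActAt
  split_ifs with hZ
  · exact hloc n Z hZ φ ψ h
  · exact local17_cpair_of_intLocalFormula hMc (Nat.le_add_right _ _) Hi.Ψ Hi.isLocal
      (fun X φ => Hi.Ψ.piece F Mc k (recordK₀ F Mc k + n) X φ) (fun X φ => rfl) Z φ ψ h

/-- **The cut pairs to `X ⊇ Z` and to `Z` agree on the sites of `Z`.** [cite: Balaban1987RG1, (1.7)–(1.9) p.261 (bookkeeping)] -/
theorem agreeOnSet_pairCutTorusAt_of_subset (a₀ ε₂₉ : ℝ) {Mc k K : ℕ} {X Z : (recordDomSys F Mc k K).Dom} (hZX : (Z.1 : Finset _) ⊆ X.1) (B : recordW F a₀ ε₂₉ k K) :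
    Sect2.agreeOnSet (Sect2.domSites (F.P K) Mc (k + 1) Z) (pairCutTorusAt F a₀ ε₂₉ Mc k K X B) (pairCutTorusAt F a₀ ε₂₉ Mc k K Z B) := by
  classical
  intro b hs ht
  have hsub := domSites_subset_of_subset (P := F.P K) Mc (k + 1) hZX
  have hbZ : b ∈ domBonds F Mc k K Z := ⟨hs, ht⟩
  have hbX : b ∈ domBonds F Mc k K X := ⟨hsub hs, hsub ht⟩
  unfold pairCutTorusAt
  simp only [hbZ, hbX, if_true, and_self]

open scoped Classical in
/-- **At a cut pair, the localised part reads the gas's own activities** `H(Z) = feActAt n Z (cut_Z B)` (`= fePolyAct n B Z`): (1.7) locality of each activity, `Z ⊆ X`.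
[cite: Balaban1987RG1, (1.7) p.261; Balaban1988RG2Cluster, (2.13) p.14] -/
theorem feLocE_pairCutTorusAt {Mc k : ℕ} (hMc : McGuard F Mc) {Hi : IntLocalFormula (F.L ^ (k + 1) * Mc)} {Hw : TorusPieces F Mc k} (hloc : Hw.LocalOnW F)
    (a₀ ε₂₉ : ℝ) (n : ℕ) (X : (recordDomSys F Mc k (recordK₀ F Mc k + n)).Dom) (B : recordW F a₀ ε₂₉ k (recordK₀ F Mc k + n)) :
    feLocE F Mc k Hi Hw n X (pairCutTorusAt F a₀ ε₂₉ Mc k (recordK₀ F Mc k + n) X B) =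
      locE TTouch (fun Z : (recordDomSys F Mc k (recordK₀ F Mc k + n)).Dom => (Z.1 : Finset _)) (fePolyAct F Mc k a₀ ε₂₉ Hi Hw n B) X.1 := by
  unfold feLocE
  exact locE_congr TTouch fun Z hZ => feActAt_congr_of_agreeOnSet hMc hloc n Z (agreeOnSet_pairCutTorusAt_of_subset a₀ ε₂₉ hZ B)

/-- **The activities at the cut pairs of a datum with `CutsInUc` decay like `A e^{−R d(Z)}`** (S₃'s hereditary row at `X = Z`). [cite: Balaban1988RG2Cluster, (2.38) p.20; Balaban1987RG1, (1.18) p.263] -/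
theorem norm_fePolyAct_le {Mc k : ℕ} {Hi : IntLocalFormula (F.L ^ (k + 1) * Mc)} {Hw : TorusPieces F Mc k} {α₀ α₁ A R : ℝ}
    (hrows : ActivityRowsW F Mc k Hi Hw α₀ α₁ A R) {a₀ ε₂₉ : ℝ} {n : ℕ} {B : recordW F a₀ ε₂₉ k (recordK₀ F Mc k + n)}
    (hB : CutsInUc F Mc k α₀ α₁ a₀ ε₂₉ n B) (Z : (recordDomSys F Mc k (recordK₀ F Mc k + n)).Dom) :
    ‖fePolyAct F Mc k a₀ ε₂₉ Hi Hw n B Z‖ ≤ A * Real.exp (-(R * (recordDomSys F Mc k (recordK₀ F Mc k + n)).dj Z)) :=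
  (hrows n Z Z subset_rfl _ (hB Z)).2

open scoped Classical in
/-- ★★ **THE IDENTITY (7) ON THE TORUS**: for a datum `B` with `CutsInUc … B` (and `CutsInUc … 0`), `Σ_{X ∈ 𝐃} fePieceT n X (cut_X B) = log Ξ(B) − log Ξ(0)` — `log Ξ = Σ_X E(X)` under
Kotecký–Preiss (from S₄'s binders at the cut pairs), `E(X)` at the gas's activities equals `feLocE n X (cut_X B)` by (1.7) locality, and the cut pairs of `0` are the unit pair.
[cite: Balaban1987RG1, (2.12)–(2.14) p.268, (1.7) p.261; Balaban1988RG2Cluster, (2.12)–(2.13) p.14] -/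
theorem sum_fePieceT_pairCutTorusAt {Mc k : ℕ} (hMc : McGuard F Mc) {Hi : IntLocalFormula (F.L ^ (k + 1) * Mc)} {Hw : TorusPieces F Mc k} (hloc : Hw.LocalOnW F)
    {α₀ α₁ A R κ : ℝ} (hrows : ActivityRowsW F Mc k Hi Hw α₀ α₁ A R) (hA : 0 ≤ A)
    (hκ : 4 * kappa₀ (4 * 2 ^ 4) (2 * 4) ≤ κ) (hR : κ + 2 * kappa₀ (4 * 2 ^ 4) (2 * 4) + 2 ≤ R)
    (hsm : A * Real.exp (5 * κ + 1) * K₀ (4 * 2 ^ 4) (2 * 4) * 9 * 64 ≤ 1)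
    {a₀ ε₂₉ : ℝ} {n : ℕ} {B : recordW F a₀ ε₂₉ k (recordK₀ F Mc k + n)} (hB : CutsInUc F Mc k α₀ α₁ a₀ ε₂₉ n B)
    (h0 : letI θ := thetaFill F a₀ ε₂₉; letI := θ.instVβ₁; letI := θ.instVβ₂; letI := θ.instιβ
      CutsInUc F Mc k α₀ α₁ a₀ ε₂₉ n (0 : recordW F a₀ ε₂₉ k (recordK₀ F Mc k + n))) :
    letI θ := thetaFill F a₀ ε₂₉; letI := θ.instVβ₁; letI := θ.instVβ₂; letI := θ.instιβ
    ∑ X : (recordDomSys F Mc k (recordK₀ F Mc k + n)).Dom, fePieceT F Mc k Hi Hw n X (pairCutTorusAt F a₀ ε₂₉ Mc k (recordK₀ F Mc k + n) X B) =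
      fePolyLogZ F Mc k a₀ ε₂₉ Hi Hw n B - fePolyLogZ F Mc k a₀ ε₂₉ Hi Hw n 0 := by
  letI θ := thetaFill F a₀ ε₂₉; letI := θ.instVβ₁; letI := θ.instVβ₂; letI := θ.instιβ
  -- Kotecký–Preiss for the gas at the cut pairs of `B` and of `0`
  have hKP := isKPVolume_torus_S4 (N := Sect2.domCount (F.P (recordK₀ F Mc k + n)) Mc (k + 1)) hA hκ hR hsm (norm_fePolyAct_le hrows hB)
  have hKP0 := isKPVolume_torus_S4 (N := Sect2.domCount (F.P (recordK₀ F Mc k + n)) Mc (k + 1)) hA hκ hR hsm (norm_fePolyAct_le hrows h0)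
  have hsplit : ∀ X : (recordDomSys F Mc k (recordK₀ F Mc k + n)).Dom,
      fePieceT F Mc k Hi Hw n X (pairCutTorusAt F a₀ ε₂₉ Mc k (recordK₀ F Mc k + n) X B) =
        locE TTouch (fun Z : (recordDomSys F Mc k (recordK₀ F Mc k + n)).Dom => (Z.1 : Finset _)) (fePolyAct F Mc k a₀ ε₂₉ Hi Hw n B) X.1 -
          locE TTouch (fun Z : (recordDomSys F Mc k (recordK₀ F Mc k + n)).Dom => (Z.1 : Finset _)) (fePolyAct F Mc k a₀ ε₂₉ Hi Hw n 0) X.1 := by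
    intro X
    unfold fePieceT
    rw [feLocE_pairCutTorusAt hMc hloc, ← pairCutTorusAt_zero F a₀ ε₂₉ Mc k n X, feLocE_pairCutTorusAt hMc hloc]
  have e1 : (∑ X : (recordDomSys F Mc k (recordK₀ F Mc k + n)).Dom,
      locE TTouch (fun Z : (recordDomSys F Mc k (recordK₀ F Mc k + n)).Dom => (Z.1 : Finset _)) (fePolyAct F Mc k a₀ ε₂₉ Hi Hw n B) X.1) =
      polymerLogZ TTouch (fePolyAct F Mc k a₀ ε₂₉ Hi Hw n B) Finset.univ := (polymerLogZ_eq_sum_locE_dom hKP).symm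
  have e0 : (∑ X : (recordDomSys F Mc k (recordK₀ F Mc k + n)).Dom,
      locE TTouch (fun Z : (recordDomSys F Mc k (recordK₀ F Mc k + n)).Dom => (Z.1 : Finset _)) (fePolyAct F Mc k a₀ ε₂₉ Hi Hw n 0) X.1) =
      polymerLogZ TTouch (fePolyAct F Mc k a₀ ε₂₉ Hi Hw n 0) Finset.univ := (polymerLogZ_eq_sum_locE_dom hKP0).symm
  simp only [hsplit, Finset.sum_sub_distrib, e1, e0]
  rfl

end Record

/-! ## §7  The (1.18) bound, (1.7) locality and (1.19) invariance of the torus pieces -/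

section Rows

open Literature.MathematicalPhysics.QuantumFieldTheory.Balaban1983to89.TreeLengthTorus (TPt IsTDom TDom torusTreeLen)
open Literature.MathematicalPhysics.QuantumFieldTheory.Balaban1983to89.B12TreeDecay (kappa₀ K₀ K₀_pos kappa₀_nonneg)
open Literature.MathematicalPhysics.QuantumFieldTheory.Balaban1983to89.B13Resummation (locE_congr)

variable {F : T4Family}

/-- **THE (1.18)-SHAPE BOUND OF A LOCALISED PART AT A PAIR OF `U^c_{k+1}(X, α₀, α₁)`**: `‖E(X)(φ)‖ ≤ e·9·64·K₀²·A·e^{−κ d(X)}` from S₃'s hereditary activity row (`Z ⊆ X`) and S₄'s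
binders. [cite: Balaban1987RG1, (1.18) p.263; Balaban1988RG2Cluster, (2.41) p.21] -/
theorem norm_feLocE_le {Mc k : ℕ} {Hi : IntLocalFormula (F.L ^ (k + 1) * Mc)} {Hw : TorusPieces F Mc k} {α₀ α₁ A R κ : ℝ}
    (hrows : ActivityRowsW F Mc k Hi Hw α₀ α₁ A R) (hA : 0 ≤ A)
    (hκ : 4 * kappa₀ (4 * 2 ^ 4) (2 * 4) ≤ κ) (hR : κ + 2 * kappa₀ (4 * 2 ^ 4) (2 * 4) + 2 ≤ R)
    (hsm : A * Real.exp (5 * κ + 1) * K₀ (4 * 2 ^ 4) (2 * 4) * 9 * 64 ≤ 1)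
    (n : ℕ) (X : (recordDomSys F Mc k (recordK₀ F Mc k + n)).Dom) {φ : Sect2.CPair (F.P (recordK₀ F Mc k + n)) (MatA 2)}
    (hφ : encodeCfg F (recordK₀ F Mc k + n) φ ∈ recordUc F Mc k α₀ α₁ (recordK₀ F Mc k + n) X) :
    ‖feLocE F Mc k Hi Hw n X φ‖ ≤ Real.exp 1 * 9 * 64 * K₀ (4 * 2 ^ 4) (2 * 4) ^ 2 * A * Real.exp (-(κ * (recordDomSys F Mc k (recordK₀ F Mc k + n)).dj X)) := by
  unfold feLocE
  exact norm_locE_torus_le_S4 (N := Sect2.domCount (F.P (recordK₀ F Mc k + n)) Mc (k + 1)) hA hκ hR hsm X.2 fun Z hZ => (hrows n X Z hZ φ hφ).2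

/-- ★ **ROW (b) FOR THE TORUS PIECES**: `‖fePieceT n X φ‖ ≤ E₂ e^{−κ d(X)}` at every pair of `U^c_{k+1}(X, α₀, α₁)`, given that the unit pair lies there too (it is the cut pair of `B = 0`) and
S₄'s `2·(e·9·64·K₀²·A) ≤ E₂`. [cite: Balaban1987RG1, (1.18) p.263, (2.14) p.268] -/
theorem norm_fePieceT_le {Mc k : ℕ} {Hi : IntLocalFormula (F.L ^ (k + 1) * Mc)} {Hw : TorusPieces F Mc k} {α₀ α₁ A R κ E₂ : ℝ}
    (hrows : ActivityRowsW F Mc k Hi Hw α₀ α₁ A R) (hA : 0 ≤ A)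
    (hκ : 4 * kappa₀ (4 * 2 ^ 4) (2 * 4) ≤ κ) (hR : κ + 2 * kappa₀ (4 * 2 ^ 4) (2 * 4) + 2 ≤ R)
    (hsm : A * Real.exp (5 * κ + 1) * K₀ (4 * 2 ^ 4) (2 * 4) * 9 * 64 ≤ 1)
    (hAE : 2 * (Real.exp 1 * 9 * 64 * K₀ (4 * 2 ^ 4) (2 * 4) ^ 2 * A) ≤ E₂)
    (n : ℕ) (X : (recordDomSys F Mc k (recordK₀ F Mc k + n)).Dom) {φ : Sect2.CPair (F.P (recordK₀ F Mc k + n)) (MatA 2)}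
    (hφ : encodeCfg F (recordK₀ F Mc k + n) φ ∈ recordUc F Mc k α₀ α₁ (recordK₀ F Mc k + n) X)
    (h1 : encodeCfg F (recordK₀ F Mc k + n) (unitCPair F (recordK₀ F Mc k + n)) ∈ recordUc F Mc k α₀ α₁ (recordK₀ F Mc k + n) X) :
    ‖fePieceT F Mc k Hi Hw n X φ‖ ≤ E₂ * Real.exp (-κ * (recordDomSys F Mc k (recordK₀ F Mc k + n)).dj X) := by
  have e := Real.exp_pos (-(κ * (recordDomSys F Mc k (recordK₀ F Mc k + n)).dj X))
  unfold fePieceT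
  calc ‖feLocE F Mc k Hi Hw n X φ - feLocE F Mc k Hi Hw n X (unitCPair F (recordK₀ F Mc k + n))‖
      ≤ ‖feLocE F Mc k Hi Hw n X φ‖ + ‖feLocE F Mc k Hi Hw n X (unitCPair F (recordK₀ F Mc k + n))‖ := norm_sub_le _ _
    _ ≤ Real.exp 1 * 9 * 64 * K₀ (4 * 2 ^ 4) (2 * 4) ^ 2 * A * Real.exp (-(κ * (recordDomSys F Mc k (recordK₀ F Mc k + n)).dj X)) +
          Real.exp 1 * 9 * 64 * K₀ (4 * 2 ^ 4) (2 * 4) ^ 2 * A * Real.exp (-(κ * (recordDomSys F Mc k (recordK₀ F Mc k + n)).dj X)) :=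
        add_le_add (norm_feLocE_le hrows hA hκ hR hsm n X hφ) (norm_feLocE_le hrows hA hκ hR hsm n X h1)
    _ = 2 * (Real.exp 1 * 9 * 64 * K₀ (4 * 2 ^ 4) (2 * 4) ^ 2 * A) * Real.exp (-(κ * (recordDomSys F Mc k (recordK₀ F Mc k + n)).dj X)) := by ring
    _ ≤ E₂ * Real.exp (-κ * (recordDomSys F Mc k (recordK₀ F Mc k + n)).dj X) := by
        rw [neg_mul]; exact mul_le_mul_of_nonneg_right hAE e.le

/-- ★ **ROW (c) FOR THE TORUS PIECES — (1.7) LOCALITY**: `fePieceT n X` reads the pair only on the sites of `X` (`E(X)` reads only `H(Z)`, `Z ⊆ X`, each (1.7)-local).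
[cite: Balaban1987RG1, (1.7) p.261] -/
theorem fePieceT_congr_of_agreeOnSet {Mc k : ℕ} (hMc : McGuard F Mc) {Hi : IntLocalFormula (F.L ^ (k + 1) * Mc)} {Hw : TorusPieces F Mc k} (hloc : Hw.LocalOnW F)
    (n : ℕ) (X : (recordDomSys F Mc k (recordK₀ F Mc k + n)).Dom) {φ ψ : Sect2.CPair (F.P (recordK₀ F Mc k + n)) (MatA 2)}
    (h : Sect2.agreeOnSet (Sect2.domSites (F.P (recordK₀ F Mc k + n)) Mc (k + 1) X) φ ψ) :
    fePieceT F Mc k Hi Hw n X φ = fePieceT F Mc k Hi Hw n X ψ := by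
  classical
  have key : ∀ Z : (recordDomSys F Mc k (recordK₀ F Mc k + n)).Dom, (Z.1 : Finset _) ⊆ X.1 →
      feActAt F Mc k Hi Hw n Z φ = feActAt F Mc k Hi Hw n Z ψ := fun Z hZ =>
    feActAt_congr_of_agreeOnSet hMc hloc n Z (Sect2.agreeOnSet_mono (domSites_subset_of_subset (P := F.P (recordK₀ F Mc k + n)) Mc (k + 1) hZ) h)
  unfold fePieceT feLocE
  rw [locE_congr TTouch key]

/-- **(1.19) INVARIANCE OF EVERY ACTIVITY** under the `SL(2,ℂ)`-valued lattice gauge group: `Hw.GaugeInvOnW` on the wrap class, ✓`gaugeInv119_cpair_of_intLocalFormula` for `Hi`'s pull-back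
pieces off it. [cite: Balaban1987RG1, (1.19) p.263, (1.10) p.262] -/
theorem feActAt_cAct {Mc k : ℕ} {Hi : IntLocalFormula (F.L ^ (k + 1) * Mc)} {Hw : TorusPieces F Mc k} (hG : Hw.GaugeInvOnW F)
    (n : ℕ) (Z : (recordDomSys F Mc k (recordK₀ F Mc k + n)).Dom) (u : recordGaugeGrp F (recordK₀ F Mc k + n)) (φ : Sect2.CPair (F.P (recordK₀ F Mc k + n)) (MatA 2)) :
    feActAt F Mc k Hi Hw n Z (Sect2.cAct u.1 φ) = feActAt F Mc k Hi Hw n Z φ := by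
  classical
  unfold feActAt
  split_ifs with hZ
  · exact hG n Z hZ u φ
  · exact gaugeInv119_cpair_of_intLocalFormula Hi.Ψ Hi.isGaugeInv (fun X φ => Hi.Ψ.piece F Mc k (recordK₀ F Mc k + n) X φ) (fun X φ => rfl) Z u φ

/-- ★ **ROW (d) FOR THE TORUS PIECES — (1.19) INVARIANCE.** [cite: Balaban1987RG1, (1.19) p.263] -/
theorem fePieceT_cAct {Mc k : ℕ} {Hi : IntLocalFormula (F.L ^ (k + 1) * Mc)} {Hw : TorusPieces F Mc k} (hG : Hw.GaugeInvOnW F)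
    (n : ℕ) (X : (recordDomSys F Mc k (recordK₀ F Mc k + n)).Dom) (u : recordGaugeGrp F (recordK₀ F Mc k + n)) (φ : Sect2.CPair (F.P (recordK₀ F Mc k + n)) (MatA 2)) :
    fePieceT F Mc k Hi Hw n X (Sect2.cAct u.1 φ) = fePieceT F Mc k Hi Hw n X φ := by
  classical
  unfold fePieceT feLocE
  rw [locE_congr TTouch fun Z _ => feActAt_cAct hG n Z u φ]

end Rows

end Summit.QuantumFields.YangMills.Theorems.BalabanUVNodesPortS1

end
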